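import Summits.BirchSwinnertonDyer.BirchSwinnertonDyer.Theorems.AdditiveBranchIMCMultLowerTameRoadsMultClosed
import Literature.NumberTheory.EllipticCurves.BSDRootNumberModularityOnlyProofs
import Literature.NumberTheory.EllipticCurves.AnalyticRankModularityProofs
import HarnessLib

/-!
# Line `tame_roads_mult` (crux `MultLower`, stmt-BirchSwinnertonDyer-19359) — the (M) road sub-row from SEVENTEEN printed theorems + `hAFC`

Corollary of `TameRoadsMultClosed.missingLowerBoundAt_of_roadRowM` (p725639): of its nineteen named printed hypotheses, the entire
continuation (`hasEntireLFunction_rat`) and the parity fact (`even_analyticRank_iff_rootNumber_eq_one`) are THEOREMS OF THE TREE given a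
modular parametrisation (`exists_isNewformOf_of_nonempty_modularParametrizationData` ⟹ `WeierstrassCurve.hasEntireLFunction_rat_of_exists_isNewformOf`,
`even_analyticRank_iff_rootNumber_eq_one_of_exists_isNewformOf`), so the (M) road sub-row in analytic rank `≤ 1` needs SEVENTEEN printed
theorems and the research statement `hAFC` (= registered stub `stub_tameAwayFromCycM`'s conclusion). BSD is proved for no curve by this file.
-/

noncomputable section

set_option linter.dupNamespace false

namespace Summit.BirchSwinnertonDyer.BirchSwinnertonDyer.Theorems.TameRoadsMultClosedSeventeen

open scoped Classical

open NumberField IsDedekindDomain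
open WeierstrassCurve Literature.NumberTheory.EllipticCurves
  Literature.NumberTheory.EllipticCurves.ModularForms
  Literature.NumberTheory.EllipticCurves.Rank1Residual
  Literature.NumberTheory.EllipticCurves.Rank1Residual.Typed

open Summit.BirchSwinnertonDyer.Rank1Residual
open Summit.BirchSwinnertonDyer.Rank1Residual.Additive
open Summit.BirchSwinnertonDyer.BirchSwinnertonDyer.Theorems
open Field Literature.NumberTheory.EllipticCurves.ModularForms
open ThreeFieldRoadSupply

/-- **THE (M) ROAD SUB-ROW FROM SEVENTEEN PRINTED THEOREMS AND THE RESEARCH STATEMENT.** Of the nineteen named printed hypotheses of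
`missingLowerBoundAt_of_roadRowM`, the entire continuation (`hasEntireLFunction_rat`) and the parity fact
(`even_analyticRank_iff_rootNumber_eq_one`) are THEOREMS OF THE TREE given a modular parametrisation (`exists_isNewformOf_of_nonempty_modularParametrizationData`,
`WeierstrassCurve.hasEntireLFunction_rat_of_exists_isNewformOf`, `even_analyticRank_iff_rootNumber_eq_one_of_exists_isNewformOf`). So the (M)
road sub-row in analytic rank `≤ 1` has `ord_p #Ш(E)_an ≤ ord_p #Ш(E)` GIVEN SEVENTEEN printed theorems and `hAFC`.
[cite: BCDTJAMS2001, Thm. A] [cite: Skinner2016PacificMC, Thm. C] [cite: JetchevSkinnerWan2017, §7.4.1] -/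
theorem missingLowerBoundAt_of_roadRowM_seventeenFacts (hDel : Delbourgo1998.prop4_rankZero_pow_dvd_constantCoeff)
    (hGZK : rank_eq_analyticRank_of_analyticRank_le_one) (hmodP : nonempty_modularParametrizationData)
    (hKato : Wuthrich2014.kato_halfEigenCharIdeal_dvd_cyclotomicPrime_of_surjective)
    (hF5 : friedbergHoffstein_exists_twist_ne_zero_ramifiedAt_splitAt)
    (hF6 : friedbergHoffstein_exists_twist_simpleZero_ramifiedAt_splitAt)
    (hGZ73 : GrossZagier1986_thm_I_7_3) (hSk : Skinner2016.thmC_padicValRat_bsd_rank_zero)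
    (hCST : CaiShuTian2014.thm11_trivialChar) (hCSTrc : CaiShuTian2014.thm11_ringClassChar)
    (hMaz : mazur_not_dvd_maninConstant_of_odd)
    (hB : Hsieh2014.thmB_exists_isHsiehLFunction_coeff_norm_eq_one_unrPeriod_ramifiedSteinberg)
    (hLZZ : LiuZhangZhang2018.thm151_thm153_modularCurve_heegnerVector_additive_ramifiedSteinberg)
    (hHL : HoffsteinLuo1997_exists_twist_L_one_ne_zero)
    (hG1 : ∀ (N : ℕ) [NeZero N] (W : WeierstrassCurve ℚ) (K : Type) [Field K] [NumberField K],
      phi_heegnerPointOfConductor_mem_range_map_ringClassField_birch N W K)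
    (hNek : Nekovar2007.cmPoint_frobeniusCongruence)
    (hP53 : ∀ (N : ℕ) [NeZero N] (W : WeierstrassCurve ℚ) (K : Type) [Field K] [NumberField K],
      GrossLMS1991.prop53_conj_pinned_birch N W K)
    (hAFC : ∀ (W : WeierstrassCurve ℚ) [W.IsElliptic] [W.IsGloballyMinimal] (p : ℕ) [Fact p.Prime]
      (K : Type) [Field K] [NumberField K],
      W.analyticRank ≤ 1 → N10.CellM W p → TameRoadRow W p → TameRoadField W p K →
      ∀ (N : ℕ) [NeZero N] (Dt : ModularParametrizationData W N), W.conductorNorm ℤ = N →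
      ∀ (κ : ZpExtension K p), κ.IsAnticyclotomic → ∀ (γ : Field.absoluteGaloisGroup K) [Fact (κ.IsTopGenerator γ)]
        (𝔭 : HeightOneSpectrum (𝓞 K)), ((p : ℕ) : 𝓞 K) ∈ 𝔭.asIdeal → 𝔭.asIdeal.ramificationIdx (𝓞 ℚ) = 1 →
        𝔭.asIdeal.inertiaDeg (𝓞 ℚ) = 1 → ∀ (𝔭' : HeightOneSpectrum (𝓞 K)), ((p : ℕ) : 𝓞 K) ∈ 𝔭'.asIdeal → 𝔭' ≠ 𝔭 →
        ∀ (ι' : PadicAlgCl p ≃+* ℂ), SchneiderFree.BranchInducesPrime p ι' 𝔭 →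
          Module.IsTorsion (IwasawaAlgebra p) (X11b.AcSelmer.XAc (W.baseChange K) p κ 𝔭' ∅ γ) →
          ∀ (κ₁ : ZpExtension K p) (γ₁ : Field.absoluteGaloisGroup K) [Fact (ZpExtension.IsTopGeneratorPair κ₁ κ γ₁ γ)],
            ∃ (A B : PowerSeries (PowerSeries (PadicComplexInt p))) (h : PowerSeries (PadicComplexInt p))
              (ΩK' : ℂ) (Ωp' : ℂ_[p]) (Q' D : PowerSeries (PadicComplexInt p)),
              h ≠ 0 ∧ ΩK' ≠ 0 ∧ Ωp' ≠ 0 ∧ X11b.R1.IsBDPLFunctionInt p ι' 𝔭 κ γ Dt.f ΩK' Ωp' Q' ∧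
              (∀ y ∈ (WeierstrassCurve.XGr₂.charIdeal (W.baseChange K) p κ₁ κ 𝔭' γ₁ γ).map
                  (IwasawaAlgebra₂.toUnr₂ p (X11b.R1.toCpInt p)),
                PowerSeries.map (PowerSeries.C : PadicComplexInt p →+* PowerSeries (PadicComplexInt p)) h * B * y ∈
                  Ideal.span {A}) ∧
              PowerSeries.constantCoeff B ≠ 0 ∧ PowerSeries.constantCoeff A = PowerSeries.constantCoeff B * D ∧
              D ≠ 0 ∧ Ideal.span {D} ≤ Ideal.span {Q'})
    (W : WeierstrassCurve ℚ) [W.IsElliptic] [W.IsGloballyMinimal] (p : ℕ) [Fact p.Prime]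
    (hr : W.analyticRank ≤ 1) (hcell : N10.CellM W p) (hrow : TameRoadRow W p)
    (htame : W.analyticRank = 1 ∨ ¬ p ∣ W.tamagawaProduct) :
    MissingLowerBoundAt W p :=
  have hnf : exists_isNewformOf := exists_isNewformOf_of_nonempty_modularParametrizationData hmodP
  TameRoadsMultClosed.missingLowerBoundAt_of_roadRowM hDel hGZK (WeierstrassCurve.hasEntireLFunction_rat_of_exists_isNewformOf hnf) hmodP hKato hF5 hF6
    (fun W' ↦ even_analyticRank_iff_rootNumber_eq_one_of_exists_isNewformOf W' hnf) hGZ73 hSk hCST hCSTrc hMaz hB hLZZ hHL hG1 hNek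
    hP53 hAFC W p hr hcell hrow htame

end Summit.BirchSwinnertonDyer.BirchSwinnertonDyer.Theorems.TameRoadsMultClosedSeventeen

end
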